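import Literature.MathematicalPhysics.QuantumFieldTheory.Balaban1983to89.B9Eq315QTorus

/-!
# `Balaban1983to89.B5Eq172HodgePositivity` — T. Bałaban, *Propagators and renormalization transformations for lattice gauge theories. I*,
# Commun. Math. Phys. **95** (1984) 17–40 [Balaban1984PropagatorsI] ("B5" = ref. [3] of [Balaban1985BackgroundPropagators]) p. 30, the
# sentence after (1.72): POSITIVITY OF `Δ_a = ∂*∂ + ∂R∂* + aQ*Q` AT THE FLAT BACKGROUND FROM THE HODGE DECOMPOSITION OF THE TORUS — the
# one-step torus PROTOTYPE of the flat positivity that the proof of [Balaban1985BackgroundPropagators] Thm 3.11 p. 416 invokes («In [4] we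
# have proved that the operator G_□(1) is positive»; there ref. [4] = *Propagators … II* [Balaban1984PropagatorsII], the localised `G_□`) —
# PROVED at the abstract Hilbert-space letters of the pub-balaban NE9 chain (`B11Eq103H1Complex.laplaceAK` / `laplaceALatticeK` with
# `R := projR (D†D) Q′`), the Hodge package DISPLAYED as five structural hypotheses

statement-level skeleton of published theorems with citation tags; proofs where landed; nothing here is a claim
about the Yang–Mills mass gap

PDF held: `paper:balaban1984-cmp95-propagators-rt-i` (journal page = PDF page + 16), pp. 20, 22, 25, 27, 29–30; `paper:balaban1985-cmp99-background-propagators`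
(journal page = PDF page + 388), pp. 394–395, 416; read by this seat (2026-08-21) in the held text layers.

THE PRINT (verbatim).  [B5] p. 29 (1.69): *«⟨A, Δ_aA⟩ = ⟨A, ∂*∂A⟩ + ⟨A, ∂R∂*A⟩ + a⟨A, Q*QA⟩ = ⟨A, ΔA⟩ − ⟨A, ∂P∂*A⟩ + a⟨A, Q*QA⟩, Δ = ∂*∂ + ∂∂*,
R = I − P»*.  p. 30: *«At first let us prove that Δ_a is a positive operator. Of course it is a symmetric operator and it is non-negative as a sum
of two non-negative operators Δ − ∂P∂* and aQ*Q, a > 0. Thus if for some A we have Δ_aA = 0, then ΔA − ∂P∂*A = 0, QA = 0. (1.72) From the first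
equation we get A = ∂Δ⁻²Q′*(Q′Δ⁻²Q′*)⁻¹ω + A₀ where A₀ is a constant vector function and ω is a function on unit lattice T₁^{(k)} orthogonal to
constant functions. Using (1.55) we have QA = ∂₁Q′Δ⁻²Q′*(Q′Δ⁻²Q′*)⁻¹ω + A₀ = ∂₁ω + A₀ = 0, hence ∂₁*∂₁ω = 0, and this implies ω = 0. The above
equation implies A₀ = 0, so A = 0 and the positivity of Δ_a follows.»*  p. 25: *«The projection operator R has a clear meaning. It is an orthogonal
projection on the linear subspace ΔN(Q′_k) of L²(T_η), N(Q′_k) = {λ : Q′_kλ = 0}. Indeed RΔλ = Δλ if Q′_kλ = 0»*.  p. 27 (1.55): *«Q_k∂ = ∂₁Q′_k, ∂₁ is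
the unit lattice differentiation»*; *«B = B′ + B₀, where B₀ is a constant configuration … we can identify Q_kA₀ = B₀»*.  p. 22: *«Constant functions
form the eigenspace corresponding to the eigenvalue 0 … the operator Q′_k transforms constant functions on the η-lattice into constant functions on
the unit lattice, and similarly for the orthogonal subspaces.»*  [B9] p. 395: *«Δ_a = Δ + DRD* + Q*aQ. It coincides with Δ_a in (2.19) [of ref. [4] = [Balaban1984PropagatorsII]] if
U = 1.»*; p. 416 (proof of Thm 3.11): *«Thus we have to prove the positivity of G₀ … it is enough to prove a positivity of the operators G_□ …
Doing the gauge transformation we get the configuration U = e^{iηA} with A small, and by (3.86) we get G_□(e^{iηA}) = G_□(1)(I − V(A)G_□(1))⁻¹. In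
[4] we have proved that the operator G_□(1) is positive»*.

WHY THIS FILE (cell context).  After the pub-balaban NE9 owner's gen-78 files the chart of the curve species `cur U` exists given ONLY the (L3)
slot `W` and the COERCIVITY of the principal gauge-fixed operator `D*D + DR(U)D* + aQ(U)*Q(U)` (`Support/NE9CurChartOfBackground.
cur_chart_exists_of_principal_coercive`, its `hγ`; the curvature part is PROVED small, `B9Ineq369CurvatureSmall`).  Print proves that coercivity
([B9] Thm 3.11) as FLAT POSITIVITY (its ref. [4] = [Balaban1984PropagatorsII], the localised `G_□(1)`; the one-step torus prototype is [B5]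
p. 30 (1.72), formalised here) + a perturbation in the gauge-fixed field.  The b05 crew holds the flat statement on ITS
carriers (`B5DeltaA169.DeltaA_posDef` for the matrix `Δ_a` on `Tor (fine n M) × Fin d → ℂ`, `B5Positivity172Lattice` for the V1 calculus); this file
is the CARRIER-FREE algebraic core at the NE9 chain's letters: the printed zero-mode argument run on abstract finite-dimensional `𝕜`-Hilbert spaces,
with exactly the lattice facts it consumes displayed as hypotheses — (H0) `0 ≤ re⟨x, Δ₁x⟩`; (H1) the torus Poincaré lemma «a curl-free bond field is
∂λ + A₀, A₀ constant»; (H2) (1.55) `Q∂ = ∂₁Q′`; (H3) `Q` maps the constants into the coarse constants, injectively («Q_kA₀ = B₀»); (H4) coarse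
gradients ⊥ coarse constants («ω … orthogonal to constant functions»); (H5) coarse constants lift to fine constants (p. 22) — each a separate
[folklore] lattice identity to be discharged at the flat background by its own file.

WHAT IS PROVED (sorry-free; no `Prop` placeholder; no inequality of the papers asserted).
* §1 `re_inner_projR_self` (`re⟨y, Ry⟩ = ‖Ry‖²` for the orthogonal projection `R = projR Δs Q′`); **`re_inner_laplaceAK_projR`**: for
  `Δ_a := laplaceAK Δ₁ D (projR (D†∘D) Q′) D† Q Q† a`, `re⟨x, Δ_a x⟩ = re⟨x, Δ₁x⟩ + ‖R(D†x)‖² + a‖Qx‖²` ((1.69)); `re_inner_laplaceAK_projR_nonneg`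
  («non-negative as a sum of … non-negative operators»).
* §2 **`laplaceAK_projR_pos_of_hodge`** (p. 30 after (1.72)): under (H0)–(H5) and `a > 0`, `0 < re⟨x, Δ_a x⟩` for `x ≠ 0` — the three terms
  vanish separately; `x = Dλ + h` by (H1); `Qx = ∂₁(Q′λ) + Qh` by (H2) with the two summands orthogonal by (H3)/(H4), so `h = 0` and `Q′λ` is a
  coarse constant, lifted by (H5) to a fine constant `κ`; `μ := λ − κ ∈ N(Q′)` has `Dμ = x`, so `R(D†x) = R(D†Dμ) = D†Dμ = D†x` (p. 25 «RΔλ = Δλ if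
  Q′λ = 0», `projR_apply_of_ker`), whence `D†x = 0` and `‖x‖² = ⟨Dμ, x⟩ = ⟨μ, D†x⟩ = 0`.
* §3 **`exists_coercive_of_rePosDef`**: on a finite-dimensional space `0 < re⟨x, Tx⟩ (x ≠ 0)` gives `γ > 0` with `γ‖x‖² ≤ re⟨x, Tx⟩` (minimum over
  the compact unit sphere) — the NON-UNIFORM coercivity constant (a finite-lattice number; the uniform `γ` is [B5] (1.90), not here);
  `coercive_of_sub_le` (coercivity survives a perturbation of relative size `δ`: constant `γ − δ` — the shape of Thm 3.11's second half, (3.86)).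
* §4 the lattice letters: **`laplaceALatticeK_pos_of_hodge`** / **`exists_coercive_laplaceALatticeK_of_hodge`** for
  `laplaceALatticeK c R S Δ₁ (RLatticeK c R S Q′) Q a` (`conj c = c`, mutually adjoint transporter data — then `D* = D†`, `B11Eq103H1Complex.
  adjoint_covDerivL2K`), from the Hodge package of `covDerivL2K c R`, `Δ₁`, `Q`, `Q′`.
* §5 AT THE FLAT BACKGROUND OF THE NE9 CHAIN: **`exists_coercive_principal_flat_of_hodge`** — the displayed `hγ` of
  `cur_chart_exists_of_principal_coercive` at `U := 1` (`principalOpK φ η 1`, `RofU L m φ η 1`, `QtorusW L m hL φ 1 …`), where (H0) is DISCHARGED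
  (`⟨x, D*Dx⟩ = ‖Dx‖²`, `B9Eq310HessianOperator.inner_covCoCurlL2K_covCurlL2K`) and (H1) reads «`covCurlL2K x = 0 ⇒ x = Dλ + h`»; (H1)–(H5) displayed.
MODEL / DECLARED READINGS.  (M1) abstract level: `E` (bond functions), `S` (gauge parameters), `F` (block fields) finite-dimensional `𝕜`-Hilbert
spaces, `F′` (coarse gauge parameters) a `𝕜`-module; `Harm ⊆ E` («constant vector functions»), `HarmC ⊆ F` (coarse constants), `∂₁ = dC : F′ → F`
are LETTERS — the hypotheses (H1)–(H5) say what they must satisfy, the sequel instantiates them on the torus.  (M2) `R := projR (D†D) Q′` = [B9]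
(3.21) / [B5] p. 25 (the NE9 chain's `RLatticeK`/`RofU`).  (M3) NOT HERE: the discharge of (H1)–(H5) for the concrete flat lattice operators
(Poincaré via `TorusChartFlatCochains`; (1.55) for [Balaban1985Averaging]'s `linQcov` at `V₀ = 1`; constants), the perturbation to `U ≠ 1`
([B9] (3.86)), any uniformity.
HONEST SCOPE.  [folklore] finite-dimensional Hilbert-space algebra reproducing a printed half-page argument; the lattice content DISPLAYED; NOT
summit progress (cell pub-balaban: NE9 NOT PRINTED / NOT PROVED; spine PROVED 0/9).  Filed by the pub-balaban NE9 BINDER-row owner lineage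
`b2b-balaban-t4-ne9-p1` (gen 79); NEW file importing `B9Eq315QTorus` only; nothing modified.  Net new unproved facts: 0.
-/

noncomputable section

open scoped InnerProductSpace ComplexConjugate

namespace Literature.MathematicalPhysics.QuantumFieldTheory.Balaban1983to89.B5Eq172HodgePositivity

open B11Eq103H1Complex (laplaceAK laplaceAK_apply projR projR_isSymmetric projR_projR projR_apply_of_ker laplaceALatticeK RLatticeK
  covLaplaceSiteK covDerivL2K covDivL2K adjoint_covDerivL2K SiteL2K BondL2K)

/-! ## §1 (1.69): the quadratic form of `Δ_a = Δ₁ + DRD† + aQ†Q`, `R` the orthogonal projection onto `D†D N(Q′)` -/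

section Form

variable {𝕜 : Type*} [RCLike 𝕜]
  {E : Type*} [NormedAddCommGroup E] [InnerProductSpace 𝕜 E] [FiniteDimensional 𝕜 E]
  {S : Type*} [NormedAddCommGroup S] [InnerProductSpace 𝕜 S] [FiniteDimensional 𝕜 S]
  {F : Type*} [NormedAddCommGroup F] [InnerProductSpace 𝕜 F] [FiniteDimensional 𝕜 F]
  {F' : Type*} [AddCommGroup F'] [Module 𝕜 F']

/-- For the orthogonal projection `R` onto `Δs N(Q′)` ([B5] p. 25 / [B9] (3.21)): `re⟨y, Ry⟩ = ‖Ry‖²` (`R` symmetric and idempotent).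
[cite: Balaban1984PropagatorsI, p.25; Balaban1985BackgroundPropagators, (3.21) p.394] -/
theorem re_inner_projR_self (Δs : S →ₗ[𝕜] S) (Q' : S →ₗ[𝕜] F') (y : S) :
    RCLike.re ⟪y, projR Δs Q' y⟫_𝕜 = ‖projR Δs Q' y‖ ^ 2 := by
  conv_lhs => rw [← projR_projR Δs Q' y, ← projR_isSymmetric Δs Q' y (projR Δs Q' y)]
  exact inner_self_eq_norm_sq _

variable (Δ₁ : E →ₗ[𝕜] E) (D : S →ₗ[𝕜] E) (Q : E →ₗ[𝕜] F) (Q' : S →ₗ[𝕜] F') (a : ℝ)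

/-- **(1.69) `⟨A, Δ_aA⟩ = ⟨A, ∂*∂A⟩ + ⟨A, ∂R∂*A⟩ + a⟨A, Q*QA⟩`, with the middle term a square**: for
`Δ_a := laplaceAK Δ₁ D (projR (D†D) Q′) D† Q Q† a`, `re⟨x, Δ_a x⟩ = re⟨x, Δ₁x⟩ + ‖R(D†x)‖² + a‖Qx‖²`.
[cite: Balaban1984PropagatorsI, (1.69) p.29] -/
theorem re_inner_laplaceAK_projR (x : E) :
    RCLike.re ⟪x, laplaceAK Δ₁ D (projR (LinearMap.adjoint D ∘ₗ D) Q') (LinearMap.adjoint D) Q (LinearMap.adjoint Q) (a : 𝕜) x⟫_𝕜 =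
      RCLike.re ⟪x, Δ₁ x⟫_𝕜 + ‖projR (LinearMap.adjoint D ∘ₗ D) Q' (LinearMap.adjoint D x)‖ ^ 2 + a * ‖Q x‖ ^ 2 := by
  rw [laplaceAK_apply, inner_add_right, inner_add_right, map_add, map_add, ← LinearMap.adjoint_inner_left D, re_inner_projR_self,
    LinearMap.adjoint_inner_right, inner_smul_right, RCLike.re_ofReal_mul, inner_self_eq_norm_sq]

/-- **«non-negative as a sum of two non-negative operators»**: if `0 ≤ re⟨x, Δ₁x⟩` and `0 ≤ a` then `0 ≤ re⟨x, Δ_a x⟩`.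
[cite: Balaban1984PropagatorsI, p.30] -/
theorem re_inner_laplaceAK_projR_nonneg (hΔ : ∀ x, 0 ≤ RCLike.re ⟪x, Δ₁ x⟫_𝕜) (ha : 0 ≤ a) (x : E) :
    0 ≤ RCLike.re ⟪x, laplaceAK Δ₁ D (projR (LinearMap.adjoint D ∘ₗ D) Q') (LinearMap.adjoint D) Q (LinearMap.adjoint Q) (a : 𝕜) x⟫_𝕜 := by
  rw [re_inner_laplaceAK_projR]
  have := hΔ x
  positivity

/-- **(1.72): on the kernel of the form the three terms vanish separately** — `re⟨x, Δ_a x⟩ ≤ 0` with `0 ≤ re⟨x, Δ₁x⟩`, `0 < a` forces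
`re⟨x, Δ₁x⟩ = 0`, `R(D†x) = 0` and `Qx = 0` («ΔA − ∂P∂*A = 0, QA = 0»). [cite: Balaban1984PropagatorsI, (1.72) p.30] -/
theorem kernel_of_re_inner_laplaceAK_projR_nonpos (hΔ : ∀ x, 0 ≤ RCLike.re ⟪x, Δ₁ x⟫_𝕜) (ha : 0 < a) {x : E}
    (hx : RCLike.re ⟪x, laplaceAK Δ₁ D (projR (LinearMap.adjoint D ∘ₗ D) Q') (LinearMap.adjoint D) Q (LinearMap.adjoint Q) (a : 𝕜) x⟫_𝕜 ≤ 0) :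
    RCLike.re ⟪x, Δ₁ x⟫_𝕜 = 0 ∧ projR (LinearMap.adjoint D ∘ₗ D) Q' (LinearMap.adjoint D x) = 0 ∧ Q x = 0 := by
  rw [re_inner_laplaceAK_projR] at hx
  have h0 := hΔ x
  have h1 : 0 ≤ ‖projR (LinearMap.adjoint D ∘ₗ D) Q' (LinearMap.adjoint D x)‖ ^ 2 := sq_nonneg _
  have h2 : 0 ≤ a * ‖Q x‖ ^ 2 := by positivity
  refine ⟨by linarith, ?_, ?_⟩
  · have h : ‖projR (LinearMap.adjoint D ∘ₗ D) Q' (LinearMap.adjoint D x)‖ ^ 2 = 0 := by linarith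
    exact norm_eq_zero.1 (pow_eq_zero_iff two_ne_zero |>.1 h)
  · have h : a * ‖Q x‖ ^ 2 = 0 := by linarith
    exact norm_eq_zero.1 (pow_eq_zero_iff two_ne_zero |>.1 ((mul_eq_zero.1 h).resolve_left ha.ne'))

end Form

/-! ## §2 p. 30 after (1.72): positivity of `Δ_a` from the Hodge package -/

section Hodge

variable {𝕜 : Type*} [RCLike 𝕜]
  {E : Type*} [NormedAddCommGroup E] [InnerProductSpace 𝕜 E] [FiniteDimensional 𝕜 E]
  {S : Type*} [NormedAddCommGroup S] [InnerProductSpace 𝕜 S] [FiniteDimensional 𝕜 S]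
  {F : Type*} [NormedAddCommGroup F] [InnerProductSpace 𝕜 F] [FiniteDimensional 𝕜 F]
  {F' : Type*} [AddCommGroup F'] [Module 𝕜 F']
  (Δ₁ : E →ₗ[𝕜] E) (D : S →ₗ[𝕜] E) (Q : E →ₗ[𝕜] F) (Q' : S →ₗ[𝕜] F') (a : ℝ)
  {Harm : Submodule 𝕜 E} {HarmC : Submodule 𝕜 F} {dC : F' →ₗ[𝕜] F}

/-- **«so A = 0 and the positivity of Δ_a follows»** — POSITIVITY OF `Δ_a = Δ₁ + DRD† + aQ†Q` (`R` = the orthogonal projection onto `D†D N(Q′)`,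
`a > 0`) FROM THE HODGE PACKAGE: (H0) `0 ≤ re⟨x, Δ₁x⟩`; (H1) Poincaré — `re⟨x, Δ₁x⟩ = 0` (curl-free) ⇒ `x = Dλ + h`, `h ∈ Harm` (constants); (H2) (1.55)
`Q∘D = ∂₁∘Q′`; (H3) `Q` maps `Harm` into the coarse constants `HarmC`, injectively; (H4) `⟨∂₁ω, h′⟩ = 0` for `h′ ∈ HarmC`; (H5) `∂₁ω = 0 ⇒ ω = Q′κ`
with `Dκ = 0`.  Then `0 < re⟨x, Δ_a x⟩` for `x ≠ 0`. [cite: Balaban1984PropagatorsI, (1.72) p.30, (1.55) p.27, p.25, p.22] -/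
theorem laplaceAK_projR_pos_of_hodge (hΔ : ∀ x, 0 ≤ RCLike.re ⟪x, Δ₁ x⟫_𝕜)
    (hHodge : ∀ x, RCLike.re ⟪x, Δ₁ x⟫_𝕜 = 0 → ∃ l : S, ∃ h ∈ Harm, x = D l + h)
    (h155 : Q ∘ₗ D = dC ∘ₗ Q') (hQHarm : ∀ h ∈ Harm, Q h ∈ HarmC) (hQinj : ∀ h ∈ Harm, Q h = 0 → h = 0)
    (hOrth : ∀ (ω : F') (h' : F), h' ∈ HarmC → ⟪dC ω, h'⟫_𝕜 = 0) (hLift : ∀ ω : F', dC ω = 0 → ∃ κ : S, D κ = 0 ∧ Q' κ = ω)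
    (ha : 0 < a) (x : E) (hx : x ≠ 0) :
    0 < RCLike.re ⟪x, laplaceAK Δ₁ D (projR (LinearMap.adjoint D ∘ₗ D) Q') (LinearMap.adjoint D) Q (LinearMap.adjoint Q) (a : 𝕜) x⟫_𝕜 := by
  refine lt_of_not_ge fun hle => ?_
  obtain ⟨eΔ, eR, eQ⟩ := kernel_of_re_inner_laplaceAK_projR_nonpos Δ₁ D Q Q' a hΔ ha hle
  -- (H1): x = Dλ + h
  obtain ⟨l, h, hh, hxe⟩ := hHodge x eΔ
  -- (H2): Qx = ∂₁(Q′λ) + Qh = 0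
  have hQD : Q (D l) = dC (Q' l) := by simpa only [LinearMap.comp_apply] using LinearMap.congr_fun h155 l
  have hsum : dC (Q' l) + Q h = 0 := by rw [← hQD, ← map_add, ← hxe, eQ]
  -- (H3)/(H4): the two summands are orthogonal, so both vanish
  have hQh : Q h = 0 := by
    have horth := hOrth (Q' l) (Q h) (hQHarm h hh)
    rw [eq_neg_of_add_eq_zero_left hsum, inner_neg_left, neg_eq_zero, inner_self_eq_zero] at horth
    exact horth
  have hh0 : h = 0 := hQinj h hh hQh
  have hdC : dC (Q' l) = 0 := by rwa [hQh, add_zero] at hsum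
  -- (H5): Q′λ is a coarse constant, lifted to a fine constant κ; μ := λ − κ ∈ N(Q′), Dμ = x
  obtain ⟨κ, hκD, hκQ⟩ := hLift (Q' l) hdC
  have hQ'μ : Q' (l - κ) = 0 := by rw [map_sub, hκQ, sub_self]
  have hDμ : D (l - κ) = x := by rw [map_sub, hκD, sub_zero, hxe, hh0, add_zero]
  -- p. 25: R(D†Dμ) = D†Dμ, i.e. R(D†x) = D†x; with R(D†x) = 0 this gives D†x = 0
  have hR := projR_apply_of_ker (LinearMap.adjoint D ∘ₗ D) Q' hQ'μ
  rw [LinearMap.comp_apply, hDμ, eR] at hR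
  -- ‖x‖² = ⟨Dμ, x⟩ = ⟨μ, D†x⟩ = 0
  have hxx : ⟪D (l - κ), x⟫_𝕜 = 0 := by
    rw [← LinearMap.adjoint_inner_right, ← hR, inner_zero_right]
  rw [hDμ] at hxx
  exact hx (inner_self_eq_zero.1 hxx)

end Hodge

/-! ## §3 Coercivity constant from positivity on a finite-dimensional space -/

section Coercive

variable {𝕜 : Type*} [RCLike 𝕜] {E : Type*} [NormedAddCommGroup E] [InnerProductSpace 𝕜 E] [FiniteDimensional 𝕜 E]

/-- **A positive definite form on a finite-dimensional space is coercive**: `0 < re⟨x, Tx⟩` for `x ≠ 0` gives `γ > 0` with `γ‖x‖² ≤ re⟨x, Tx⟩`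
for all `x` (the minimum of the form over the compact unit sphere) — the shape of the displayed `hγ` of the NE9 chain («positive definite»
in [B9] Thm 3.11 / «Δ_a is a positive operator … It is an invertible operator» in [B5] p. 30, read quantitatively on a finite lattice); the
constant is a finite-lattice number, NOT print's uniform one ([B5] (1.90) p. 33).
[cite: Balaban1985BackgroundPropagators, Thm 3.11 p.416; Balaban1984PropagatorsI, p.30] -/
theorem exists_coercive_of_rePosDef {T : E →ₗ[𝕜] E} (hpos : ∀ x : E, x ≠ 0 → 0 < RCLike.re ⟪x, T x⟫_𝕜) :
    ∃ γ : ℝ, 0 < γ ∧ ∀ x : E, γ * ‖x‖ ^ 2 ≤ RCLike.re ⟪x, T x⟫_𝕜 := by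
  have hcont : Continuous fun x : E => RCLike.re ⟪x, T x⟫_𝕜 :=
    RCLike.continuous_re.comp (continuous_id.inner T.continuous_of_finiteDimensional)
  haveI : ProperSpace E := FiniteDimensional.proper_rclike 𝕜 E
  -- the normalisation `‖x‖⁻¹ • x` of a non-zero vector lies on the unit sphere
  have hunit : ∀ x : E, x ≠ 0 → ((‖x‖⁻¹ : ℝ) : 𝕜) • x ∈ Metric.sphere (0 : E) 1 := fun x hx => by
    have hxn : 0 < ‖x‖ := norm_pos_iff.2 hx
    rw [mem_sphere_zero_iff_norm, norm_smul, RCLike.norm_ofReal, abs_of_pos (inv_pos.2 hxn), inv_mul_cancel₀ hxn.ne']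
  by_cases hE : ∃ x₀ : E, x₀ ≠ 0
  · obtain ⟨x₀, hx₀⟩ := hE
    obtain ⟨u, hu, hmin⟩ := (isCompact_sphere (0 : E) 1).exists_isMinOn ⟨_, hunit x₀ hx₀⟩ hcont.continuousOn
    have hu1 : ‖u‖ = 1 := mem_sphere_zero_iff_norm.1 hu
    have hu0 : u ≠ 0 := by rw [← norm_ne_zero_iff, hu1]; exact one_ne_zero
    refine ⟨RCLike.re ⟪u, T u⟫_𝕜, hpos u hu0, fun x => ?_⟩
    by_cases hx : x = 0
    · rw [hx, norm_zero, inner_zero_left, map_zero]; simp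
    · have hxn : 0 < ‖x‖ := norm_pos_iff.2 hx
      have hle := hmin (hunit x hx)
      simp only [Set.mem_setOf_eq, map_smul, inner_smul_left, inner_smul_right, RCLike.conj_ofReal, ← mul_assoc] at hle
      rw [← RCLike.ofReal_mul, RCLike.re_ofReal_mul] at hle
      have hsq : ‖x‖⁻¹ * ‖x‖⁻¹ * ‖x‖ ^ 2 = 1 := by field_simp
      calc RCLike.re ⟪u, T u⟫_𝕜 * ‖x‖ ^ 2 ≤ ‖x‖⁻¹ * ‖x‖⁻¹ * RCLike.re ⟪x, T x⟫_𝕜 * ‖x‖ ^ 2 :=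
            mul_le_mul_of_nonneg_right hle (sq_nonneg _)
        _ = RCLike.re ⟪x, T x⟫_𝕜 := by rw [mul_comm _ (RCLike.re _), mul_assoc, hsq, mul_one]
  · have hE' : ∀ x : E, x = 0 := fun x => by_contra fun hx => hE ⟨x, hx⟩
    refine ⟨1, one_pos, fun x => ?_⟩
    rw [hE' x, norm_zero, inner_zero_left, map_zero]; simp

omit [FiniteDimensional 𝕜 E] in
/-- **Coercivity survives a small perturbation** — the shape of the SECOND half of [B9] Thm 3.11's proof (p. 416: `G_□(U) = G_□(1)(I − V(A)G_□(1))⁻¹`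
with `V(A)` small; (3.86)): if `γ‖x‖² ≤ re⟨x, Tx⟩` and `‖(S − T)x‖ ≤ δ‖x‖` then `(γ − δ)‖x‖² ≤ re⟨x, Sx⟩`.  At a fixed lattice this turns the
chain's displayed `hγ` at a background `U` into the flat coercivity (this file and its sequels) + an operator-norm closeness of `Δ_a(U)` to `Δ_a(1)`.
[cite: Balaban1985BackgroundPropagators, Thm 3.11 p.416, (3.86) p.407] -/
theorem coercive_of_sub_le {T S : E →ₗ[𝕜] E} {γ δ : ℝ} (hT : ∀ x : E, γ * ‖x‖ ^ 2 ≤ RCLike.re ⟪x, T x⟫_𝕜)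
    (hST : ∀ x : E, ‖S x - T x‖ ≤ δ * ‖x‖) (x : E) : (γ - δ) * ‖x‖ ^ 2 ≤ RCLike.re ⟪x, S x⟫_𝕜 := by
  have hsplit : RCLike.re ⟪x, S x⟫_𝕜 = RCLike.re ⟪x, T x⟫_𝕜 + RCLike.re ⟪x, S x - T x⟫_𝕜 := by
    rw [← map_add, ← inner_add_right, add_sub_cancel]
  have hpert : -(δ * ‖x‖ ^ 2) ≤ RCLike.re ⟪x, S x - T x⟫_𝕜 := by
    have h1 : |RCLike.re ⟪x, S x - T x⟫_𝕜| ≤ ‖x‖ * (δ * ‖x‖) :=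
      ((RCLike.abs_re_le_norm _).trans (norm_inner_le_norm _ _)).trans (mul_le_mul_of_nonneg_left (hST x) (norm_nonneg _))
    rw [abs_le] at h1
    nlinarith [h1.1]
  rw [hsplit]
  nlinarith [hT x, hpert]

end Coercive

/-! ## §4 The lattice letters: `Δ_{1,a}` with `Rr := RLatticeK` (the NE9 chain's `laplaceALatticeK`) -/

section Lattice

open B9SectCLatticeCarrier (Bond)
open B4Sect5Torus (TSite)

variable {𝕜 : Type*} [RCLike 𝕜] {d : ℕ} {Pd : Fin d → ℕ} {W : Type*} [NormedAddCommGroup W] [InnerProductSpace 𝕜 W] [FiniteDimensional 𝕜 W]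
  {c₀ : ℝ} [Fact (0 < c₀)] {F : Type*} [NormedAddCommGroup F] [InnerProductSpace 𝕜 F] [FiniteDimensional 𝕜 F]
  {F' : Type*} [AddCommGroup F'] [Module 𝕜 F']
  (c : 𝕜) (hc : conj c = c) (R S : Bond d Pd → W →ₗ[𝕜] W) (hRS : ∀ (b : Bond d Pd) (v u : W), ⟪R b v, u⟫_𝕜 = ⟪v, S b u⟫_𝕜)
  (Δ₁ : BondL2K 𝕜 d Pd c₀ W →ₗ[𝕜] BondL2K 𝕜 d Pd c₀ W) (Q : BondL2K 𝕜 d Pd c₀ W →ₗ[𝕜] F) (Q' : SiteL2K 𝕜 d Pd c₀ W →ₗ[𝕜] F') (a : ℝ)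
  {Harm : Submodule 𝕜 (BondL2K 𝕜 d Pd c₀ W)} {HarmC : Submodule 𝕜 F} {dC : F' →ₗ[𝕜] F}

include hc hRS

/-- With mutually adjoint transporter data the NE9 chain's `Δ_{1,a}` with `Rr := RLatticeK c R S Q′` IS §1's operator at `D := covDerivL2K c R`
(`D* = D†`, `B11Eq103H1Complex.adjoint_covDerivL2K`). [cite: Balaban1985BackgroundPropagators, (3.21)–(3.26) pp.394–395] -/
theorem laplaceALatticeK_RLatticeK_eq :
    laplaceALatticeK c R S Δ₁ (RLatticeK c R S Q') Q a =
      laplaceAK Δ₁ (covDerivL2K 𝕜 c₀ c R) (projR (LinearMap.adjoint (covDerivL2K 𝕜 c₀ c R) ∘ₗ covDerivL2K 𝕜 c₀ c R) Q')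
        (LinearMap.adjoint (covDerivL2K 𝕜 c₀ c R)) Q (LinearMap.adjoint Q) (a : 𝕜) := by
  simp only [laplaceALatticeK, RLatticeK, covLaplaceSiteK, ← adjoint_covDerivL2K c hc R S hRS]

/-- **POSITIVITY OF THE LATTICE `Δ_{1,a}` (with `R := RLatticeK`, `a > 0`) FROM THE HODGE PACKAGE** of `D := covDerivL2K c R`, `Δ₁`, `Q`, `Q′` —
§2 at the lattice letters; [B9] p. 395 «It coincides with Δ_a in (2.19) [of ref. [4] = Propagators II] if U = 1»; one-step prototype [B5] p. 30.
[cite: Balaban1984PropagatorsI, (1.72) p.30; Balaban1985BackgroundPropagators, (3.26) p.395, Thm 3.11 p.416] -/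
theorem laplaceALatticeK_pos_of_hodge (hΔ : ∀ x, 0 ≤ RCLike.re ⟪x, Δ₁ x⟫_𝕜)
    (hHodge : ∀ x, RCLike.re ⟪x, Δ₁ x⟫_𝕜 = 0 → ∃ l, ∃ h ∈ Harm, x = covDerivL2K 𝕜 c₀ c R l + h)
    (h155 : Q ∘ₗ covDerivL2K 𝕜 c₀ c R = dC ∘ₗ Q') (hQHarm : ∀ h ∈ Harm, Q h ∈ HarmC) (hQinj : ∀ h ∈ Harm, Q h = 0 → h = 0)
    (hOrth : ∀ (ω : F') (h' : F), h' ∈ HarmC → ⟪dC ω, h'⟫_𝕜 = 0)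
    (hLift : ∀ ω : F', dC ω = 0 → ∃ κ, covDerivL2K 𝕜 c₀ c R κ = 0 ∧ Q' κ = ω) (ha : 0 < a)
    (x : BondL2K 𝕜 d Pd c₀ W) (hx : x ≠ 0) :
    0 < RCLike.re ⟪x, laplaceALatticeK c R S Δ₁ (RLatticeK c R S Q') Q a x⟫_𝕜 := by
  rw [laplaceALatticeK_RLatticeK_eq c hc R S hRS]
  exact laplaceAK_projR_pos_of_hodge Δ₁ _ Q Q' a hΔ hHodge h155 hQHarm hQinj hOrth hLift ha x hx

/-- … hence COERCIVE with some `γ > 0` — the shape of the displayed `hγ` of `Support/NE9CurChartOfBackground.cur_chart_exists_of_principal_coercive`.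
[cite: Balaban1984PropagatorsI, (1.72) p.30; Balaban1985BackgroundPropagators, Thm 3.11 p.416] -/
theorem exists_coercive_laplaceALatticeK_of_hodge (hΔ : ∀ x, 0 ≤ RCLike.re ⟪x, Δ₁ x⟫_𝕜)
    (hHodge : ∀ x, RCLike.re ⟪x, Δ₁ x⟫_𝕜 = 0 → ∃ l, ∃ h ∈ Harm, x = covDerivL2K 𝕜 c₀ c R l + h)
    (h155 : Q ∘ₗ covDerivL2K 𝕜 c₀ c R = dC ∘ₗ Q') (hQHarm : ∀ h ∈ Harm, Q h ∈ HarmC) (hQinj : ∀ h ∈ Harm, Q h = 0 → h = 0)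
    (hOrth : ∀ (ω : F') (h' : F), h' ∈ HarmC → ⟪dC ω, h'⟫_𝕜 = 0)
    (hLift : ∀ ω : F', dC ω = 0 → ∃ κ, covDerivL2K 𝕜 c₀ c R κ = 0 ∧ Q' κ = ω) (ha : 0 < a) :
    ∃ γ : ℝ, 0 < γ ∧ ∀ x : BondL2K 𝕜 d Pd c₀ W, γ * ‖x‖ ^ 2 ≤ RCLike.re ⟪x, laplaceALatticeK c R S Δ₁ (RLatticeK c R S Q') Q a x⟫_𝕜 :=
  exists_coercive_of_rePosDef (laplaceALatticeK_pos_of_hodge c hc R S hRS Δ₁ Q Q' a hΔ hHodge h155 hQHarm hQinj hOrth hLift ha)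

end Lattice

/-! ## §5 At the FLAT background of the NE9 chain: the displayed `hγ` of `cur_chart_exists_of_principal_coercive` at `U := 1` from the Hodge package -/

section Flat

open B9SectCLatticeCarrier (Bond)
open B4Sect5Torus (TSite)
open B7Prop1Explicit (U1 Wcx boxVec)
open B9Eq319QprimeTorus (fineP)
open B9Eq310HessianOperator (adTransportW adTransportW_apply principalOpK principalOpK_eq_comp covCurlL2K inner_covCoCurlL2K_covCurlL2K)
open B9Eq326OperatorAssembly (RofU QprimeW)
open B9Eq315QTorus (perCfg cornerSite QtorusW)

variable {d : ℕ} {Pd : Fin d → ℕ} {𝔸 : Type*} [Ring 𝔸] [Algebra ℂ 𝔸] {W : Type*} [NormedAddCommGroup W] [InnerProductSpace ℂ W]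
  (φ : W ≃ₗ[ℂ] 𝔸)

/-- At the flat background the transporter read on the Hilbert fibre is the identity (`R(1)X = X`). [cite: Balaban1985BackgroundPropagators, p.390, p.395] -/
theorem adTransportW_one (b : Bond d Pd) : adTransportW φ (fun _ : Bond d Pd => (1 : 𝔸ˣ)) b = LinearMap.id := by
  apply LinearMap.ext
  intro w
  rw [adTransportW_apply, LinearMap.id_apply, Units.val_one, inv_one, Units.val_one, one_mul, mul_one, LinearEquiv.symm_apply_apply]

/-- … and so is the adjoint transporter `R(1⁻¹)`. [cite: Balaban1985BackgroundPropagators, p.390, p.395] -/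
theorem adTransportW_inv_one (b : Bond d Pd) : adTransportW φ (fun _ : Bond d Pd => (1 : 𝔸ˣ)⁻¹) b = LinearMap.id := by
  rw [inv_one, adTransportW_one]

/-- The flat transporter data are (trivially) mutually adjoint — the `hRS` of the chain at `U = 1`. [cite: Balaban1985BackgroundPropagators, p.395] -/
theorem hRS_one (b : Bond d Pd) (v u : W) :
    ⟪adTransportW φ (fun _ : Bond d Pd => (1 : 𝔸ˣ)) b v, u⟫_ℂ = ⟪v, adTransportW φ (fun _ : Bond d Pd => (1 : 𝔸ˣ)⁻¹) b u⟫_ℂ := by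
  rw [adTransportW_one, adTransportW_inv_one, LinearMap.id_apply, LinearMap.id_apply]

/-- The scalar `η⁻¹` of (3.3)/(3.4) is real: `conj η⁻¹ = η⁻¹`. [cite: Balaban1985BackgroundPropagators, (3.3) p.391] -/
theorem conj_inv_ofReal (η : ℝ) : conj (((η : ℂ))⁻¹) = ((η : ℂ))⁻¹ := by
  rw [map_inv₀, Complex.conj_ofReal]

variable {c₀ : ℝ} [Fact (0 < c₀)] [FiniteDimensional ℂ W] (η : ℝ)

/-- **(H0) DISCHARGED at the flat background: `re⟨x, D*Dx⟩ = ‖Dx‖² ≥ 0`** for the chain's `principalOpK φ η 1`.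
[cite: Balaban1985BackgroundPropagators, (3.10) p.392] -/
theorem re_inner_principalOpK_one (x : BondL2K ℂ d Pd c₀ W) :
    RCLike.re ⟪x, principalOpK φ η (fun _ : Bond d Pd => (1 : 𝔸ˣ)) x⟫_ℂ =
      ‖covCurlL2K ℂ c₀ ((η : ℂ))⁻¹ (adTransportW φ (fun _ : Bond d Pd => (1 : 𝔸ˣ))) x‖ ^ 2 := by
  rw [principalOpK_eq_comp, LinearMap.comp_apply,
    inner_covCoCurlL2K_covCurlL2K _ (conj_inv_ofReal η) _ _ (hRS_one φ), ← RCLike.ofReal_pow, RCLike.ofReal_re]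

/-- … so `re⟨x, D*Dx⟩ = 0` iff `x` is CURL-FREE. [cite: Balaban1985BackgroundPropagators, (3.10) p.392] -/
theorem covCurlL2K_eq_zero_of_re_inner_principalOpK_one {x : BondL2K ℂ d Pd c₀ W}
    (hx : RCLike.re ⟪x, principalOpK φ η (fun _ : Bond d Pd => (1 : 𝔸ˣ)) x⟫_ℂ = 0) :
    covCurlL2K ℂ c₀ ((η : ℂ))⁻¹ (adTransportW φ (fun _ : Bond d Pd => (1 : 𝔸ˣ))) x = 0 := by
  rw [re_inner_principalOpK_one] at hx
  exact norm_eq_zero.1 (pow_eq_zero_iff two_ne_zero |>.1 hx)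

end Flat

section FlatMain

open B9SectCLatticeCarrier (Bond)
open B4Sect5Torus (TSite)
open B7Prop1Explicit (U1 Wcx boxVec)
open B9Eq319QprimeTorus (fineP)
open B9Eq310HessianOperator (adTransportW principalOpK covCurlL2K)
open B9Eq326OperatorAssembly (RofU QprimeW)
open B9Eq315QTorus (perCfg cornerSite QtorusW)

variable {d : ℕ} {𝔸 : Type*} [NormedRing 𝔸] [NormedAlgebra ℂ 𝔸] [CompleteSpace 𝔸] [NormOneClass 𝔸]
  {W : Type*} [NormedAddCommGroup W] [InnerProductSpace ℂ W] [FiniteDimensional ℂ W] (φ : W ≃ₗ[ℂ] 𝔸) {c₀ : ℝ} [Fact (0 < c₀)] (η : ℝ)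
  (L : ℕ) [NeZero L] (m : Fin d → ℕ) [∀ i, NeZero (fineP L m i)] (hL : 1 ≤ L) {c₁ : ℝ} [Fact (0 < c₁)]
  {α : ℝ} (hα1 : α ≤ 1 / 64)
  (hU1 : ∀ (x : B7Prop1Explicit.Site d) (κ : Fin d), perCfg (fineP L m) (fun _ : Bond d (fineP L m) => (1 : 𝔸ˣ)) x κ ∈ U1 𝔸)
  (hreg : ∀ (y : TSite d m) (κ : Fin d) (r : Fin d → Fin L),
    ‖((Wcx L (perCfg (fineP L m) (fun _ : Bond d (fineP L m) => (1 : 𝔸ˣ))) (cornerSite L y) κ (boxVec L r) : 𝔸ˣ) : 𝔸) - 1‖ ≤ α)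
  (a : ℝ) {Harm : Submodule ℂ (BondL2K ℂ d (fineP L m) c₀ W)} {HarmC : Submodule ℂ (BondL2K ℂ d m c₁ W)}
  {dC : (TSite d m → W) →ₗ[ℂ] BondL2K ℂ d m c₁ W}

/-- **THE DISPLAYED COERCIVITY `hγ` OF THE NE9 CHAIN AT THE FLAT BACKGROUND, FROM THE HODGE PACKAGE** — for
`Δ_a(1) = D*D + D R(1) D* + a Q(1)*Q(1)` (`principalOpK φ η 1`, `RofU L m φ η 1`, `QtorusW L m hL φ 1 …`; [B9] p. 395 «It coincides with Δ_a in
(2.19) [of ref. [4]] if U = 1») there is `γ > 0` with `γ‖x‖² ≤ re⟨x, Δ_a(1)x⟩`, given (H1) the torus Poincaré lemma for the chain's curl/gradient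
(«curl-free ⇒ `Dλ + h`, `h ∈ Harm`»), (H2) (1.55) `Q(1)∘D = ∂₁∘Q′(1)`, (H3) `Q(1)` maps `Harm` into `HarmC` injectively, (H4) `∂₁ω ⊥ HarmC`,
(H5) `∂₁ω = 0 ⇒ ω = Q′(1)κ`, `Dκ = 0` — (H0) discharged here; the constant `γ` is a finite-lattice number (uniformity = [B5] (1.90), not here).
[cite: Balaban1984PropagatorsI, (1.72) p.30; Balaban1985BackgroundPropagators, (3.26) p.395, Thm 3.11 p.416] -/
theorem exists_coercive_principal_flat_of_hodge
    (hHodge : ∀ x : BondL2K ℂ d (fineP L m) c₀ W,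
      covCurlL2K ℂ c₀ ((η : ℂ))⁻¹ (adTransportW φ (fun _ : Bond d (fineP L m) => (1 : 𝔸ˣ))) x = 0 →
        ∃ l, ∃ h ∈ Harm, x = covDerivL2K ℂ c₀ ((η : ℂ))⁻¹ (adTransportW φ (fun _ : Bond d (fineP L m) => (1 : 𝔸ˣ))) l + h)
    (h155 : QtorusW L m hL φ (fun _ => 1) hα1 hU1 hreg (c₁ := c₁) ∘ₗ
        covDerivL2K ℂ c₀ ((η : ℂ))⁻¹ (adTransportW φ (fun _ : Bond d (fineP L m) => (1 : 𝔸ˣ))) =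
      dC ∘ₗ QprimeW L m φ (fun _ : Bond d (fineP L m) => (1 : 𝔸ˣ)))
    (hQHarm : ∀ h ∈ Harm, QtorusW L m hL φ (fun _ => 1) hα1 hU1 hreg (c₁ := c₁) h ∈ HarmC)
    (hQinj : ∀ h ∈ Harm, QtorusW L m hL φ (fun _ => 1) hα1 hU1 hreg (c₁ := c₁) h = 0 → h = 0)
    (hOrth : ∀ (ω : TSite d m → W) (h' : BondL2K ℂ d m c₁ W), h' ∈ HarmC → ⟪dC ω, h'⟫_ℂ = 0)
    (hLift : ∀ ω : TSite d m → W, dC ω = 0 →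
      ∃ κ, covDerivL2K ℂ c₀ ((η : ℂ))⁻¹ (adTransportW φ (fun _ : Bond d (fineP L m) => (1 : 𝔸ˣ))) κ = 0 ∧
        QprimeW L m φ (fun _ : Bond d (fineP L m) => (1 : 𝔸ˣ)) κ = ω)
    (ha : 0 < a) :
    ∃ γ : ℝ, 0 < γ ∧ ∀ x : BondL2K ℂ d (fineP L m) c₀ W, γ * ‖x‖ ^ 2 ≤
      RCLike.re ⟪x, laplaceALatticeK ((η : ℂ))⁻¹ (adTransportW φ (fun _ : Bond d (fineP L m) => (1 : 𝔸ˣ)))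
        (adTransportW φ fun _ : Bond d (fineP L m) => (1 : 𝔸ˣ)⁻¹) (principalOpK φ η fun _ => 1) (RofU L m φ η fun _ => 1)
        (QtorusW L m hL φ (fun _ => 1) hα1 hU1 hreg (c₁ := c₁)) a x⟫_ℂ := by
  rw [RofU]
  exact exists_coercive_laplaceALatticeK_of_hodge _ (conj_inv_ofReal η) _ _ (hRS_one φ) _ _ _ a
    (fun x => by rw [re_inner_principalOpK_one]; positivity)
    (fun x hx => hHodge x (covCurlL2K_eq_zero_of_re_inner_principalOpK_one φ η hx)) h155 hQHarm hQinj hOrth hLift ha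

end FlatMain

end Literature.MathematicalPhysics.QuantumFieldTheory.Balaban1983to89.B5Eq172HodgePositivity

end
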